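import Literature.MathematicalPhysics.QuantumFieldTheory.Balaban1983to89.B9Eq316AveragingTransposeZd

/-!
# `Balaban1983to89.B9B8KnitKernelTranspose` — the (B)-line bond junction, file c1: THE FIBRE TRANSPOSE `entryT` OF A TRANSPORTED MULTIPLE
# `X ↦ m·R(T)X` IS `m·R(T⁻¹)` (unitary `T`, tracial faithful `τ`), AND THE TRANSPOSE OF A SMALL DIFFERENCE IS SMALL — the two bookkeeping facts the
# averaging closeness (c′) needs to compare the knit's genuine transpose `Q_jᵀ` (built entry by entry with `entryT`) with def-Y's `Q*(U)` (inverse transporters)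

statement-level skeleton of published theorems with citation tags; proofs where landed; nothing here is a claim about the
Yang–Mills mass gap

Sub-row G-B8-T2S (unit `lit-balaban-t2s-1`, gen 7), RULING #10 road, crux (c′) (design `lit-balaban-t2s-1/g7/BLINE-DESIGN-g7.md` §2).  The knit's averaging
letter `Q*aQ` ([4] (3.16)) is `w_j·Q_jᵀ(𝟙·LʲηQ_j(U₀)A)` with `Q_jᵀ` the REAL transpose for the fibre pairing `⟨x, y⟩_τ = Re τ(x*y)`, assembled column by column
from `B9Eq316AveragingTransposeZd.entryT`; def-Y's `Q*(U)` ([4] (3.13)) transports back with the INVERSE transporters.  The comparison of the two transposes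
rests on: (a) `entryT` is additive in the map and in the vector, so the transpose of a difference is the difference of the transposes and
`‖E₁ᵀv − E₂ᵀv‖ ≤ C_τβ_τ·δ·‖v‖` when `‖E₁X − E₂X‖ ≤ δ‖X‖` (`norm_entryT_le`); (b) for a unitary `T` and a tracial faithful Hermitian-type `τ` the transpose of
`X ↦ m·TXT⁻¹` is EXACTLY `v ↦ m·T⁻¹vT` — «R(U)* = R(U⁻¹)» for the trace pairing.  Print: [4] p. 391 («X·Y = tr XY»), (3.13) p. 393, (3.16) p. 393; [5] (147) p. 40.

WHAT IS PROVED (kernel, 0 sorry; theorems only, no `def`, no `… : Prop` fact, no `instance`).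
* §1 `entryT_sub_left`, `entryT_sub_right`, `norm_entryT_sub_left_le`, `entryT_eq_of_forall_tauForm` (uniqueness of the transpose by nondegeneracy).
* §2 ★ `tauForm_conjR_inv_left` (`⟨m·R(T⁻¹)v, X⟩_τ = ⟨v, m·R(T)X⟩_τ`), ★★ `entryT_smul_conjR`
  (`(X ↦ m·R(T)X)ᵀ v = m·R(T⁻¹)v`), `entryT_smul` (`(X ↦ m·X)ᵀ v = m·v`).
* §3 ★ `norm_entryT_pair_sub_le` — one column of the comparison: `‖E₁ᵀv₁ − E₂ᵀv₂‖ ≤ C_τβ_τ(δ‖v₁‖ + K₂‖v₁ − v₂‖)` from `‖E₁ − E₂‖ ≤ δ`, `‖E₂‖ ≤ K₂`.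

HONEST SCOPE.  Fibre bookkeeping only; no statement about the averaging operators themselves; count-neutral; nothing continuum ∕ ℝ⁴ ∕ OS ∕ mass gap ∕ Clay —
the Yang–Mills mass gap is NOT proved here.  NEW file; `B9Eq316AveragingTransposeZd` is used BY NAME, nothing landed is modified.
-/

noncomputable section

namespace Literature.MathematicalPhysics.QuantumFieldTheory.Balaban1983to89.B9B8KnitKernelTranspose

open scoped BigOperators
open B9Eq316AveragingTransposeZd (tauForm tauForm_apply tauForm_nondegenerate tauForm_entryT entryT betaTau norm_entryT_le)
open B7Eq78Linearization (conjR conjR_apply)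
open B7Prop2Explicit (unitaryUnits)

variable {𝔸 : Type*} [CStarAlgebra 𝔸] (τ : 𝔸 →ₗ[ℂ] ℂ) [FiniteDimensional ℝ 𝔸]

/-! ## §1 `entryT` is additive in the map and in the vector -/

/-- the transpose of a difference of maps is the difference of the transposes (no linearity used). [cite: Balaban1985BackgroundPropagators, (3.16) p.393, bookkeeping] -/
theorem entryT_sub_left (E₁ E₂ : 𝔸 → 𝔸) (v : 𝔸) : entryT τ E₁ v - entryT τ E₂ v = entryT τ (fun X => E₁ X - E₂ X) v := by
  classical
  unfold entryT
  split_ifs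
  · rw [← Finset.sum_sub_distrib]
    refine Finset.sum_congr rfl fun i _ => ?_
    rw [map_sub, sub_smul]
  · rw [sub_zero]

/-- `Eᵀ` is additive in the vector: `Eᵀ(v − w) = Eᵀv − Eᵀw` (no linearity of `E` used). [cite: Balaban1985BackgroundPropagators, (3.16) p.393, bookkeeping] -/
theorem entryT_sub_right (E : 𝔸 → 𝔸) (v w : 𝔸) : entryT τ E (v - w) = entryT τ E v - entryT τ E w := by
  classical
  unfold entryT
  split_ifs
  · rw [← Finset.sum_sub_distrib]
    refine Finset.sum_congr rfl fun i _ => ?_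
    rw [map_sub, LinearMap.sub_apply, sub_smul]
  · rw [sub_zero]

/-- ★ **THE TRANSPOSE OF A SMALL DIFFERENCE IS SMALL**: `‖E₁X − E₂X‖ ≤ δ‖X‖` for all `X` ⟹ `‖E₁ᵀv − E₂ᵀv‖ ≤ C_τ·β_τ·δ·‖v‖`.
[cite: Balaban1985Averaging, (147) p.40; Balaban1985BackgroundPropagators, (3.16) p.393] -/
theorem norm_entryT_sub_left_le [Nontrivial 𝔸] {Cτ : ℝ} (hCτ : ∀ x y : 𝔸, |(τ (star x * y)).re| ≤ Cτ * ‖x‖ * ‖y‖) {E₁ E₂ : 𝔸 → 𝔸} {δ : ℝ}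
    (hδ : 0 ≤ δ) (h : ∀ X, ‖E₁ X - E₂ X‖ ≤ δ * ‖X‖) (v : 𝔸) : ‖entryT τ E₁ v - entryT τ E₂ v‖ ≤ Cτ * betaTau τ * δ * ‖v‖ := by
  rw [entryT_sub_left]
  exact norm_entryT_le τ hCτ hδ (fun i => h _) v

/-- **UNIQUENESS OF THE TRANSPOSE**: for a faithful positive `τ` and a real-linear `E`, any `w` with `⟨w, X⟩_τ = ⟨v, EX⟩_τ` for all `X` IS `Eᵀv`.
[cite: Balaban1985BackgroundPropagators, p.391 («X·Y = tr XY»), (3.16) p.393] -/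
theorem entryT_eq_of_forall_tauForm (hτp : ∀ a : 𝔸, a ≠ 0 → 0 < (τ (star a * a)).re) {E : 𝔸 → 𝔸}
    (hEadd : ∀ x y, E (x + y) = E x + E y) (hEsmul : ∀ (c : ℝ) x, E (c • x) = c • E x) {v w : 𝔸}
    (h : ∀ X, tauForm τ w X = tauForm τ v (E X)) : entryT τ E v = w := by
  have hN := tauForm_nondegenerate τ hτp
  have h0 : ∀ X, tauForm τ (entryT τ E v - w) X = 0 := fun X => by
    rw [map_sub, LinearMap.sub_apply, tauForm_entryT τ hτp hEadd hEsmul, h, sub_self]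
  exact sub_eq_zero.1 (hN.1 _ h0)

/-! ## §2 The transpose of a transported multiple -/

omit [FiniteDimensional ℝ 𝔸] in
/-- ★ **«R(T)* = R(T⁻¹)» FOR THE TRACE PAIRING**: `⟨m·R(T⁻¹)v, X⟩_τ = ⟨v, m·R(T)X⟩_τ` for a unitary `T`, a real `m` and a tracial `τ`.
[cite: Balaban1985BackgroundPropagators, p.391 («X·Y = tr XY»), (3.13) p.393] -/
theorem tauForm_conjR_inv_left (hτt : ∀ a b : 𝔸, τ (a * b) = τ (b * a)) {T : 𝔸ˣ} (hT : T ∈ unitaryUnits 𝔸) (m : ℝ) (v X : 𝔸) :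
    tauForm τ (((m : ℝ) : ℂ) • conjR T⁻¹ v) X = tauForm τ v (((m : ℝ) : ℂ) • conjR T X) := by
  have hu : (T : 𝔸) ∈ unitary 𝔸 := hT
  have hinv : ((T⁻¹ : 𝔸ˣ) : 𝔸) = star (T : 𝔸) := Units.inv_eq_of_mul_eq_one_right (Unitary.mul_star_self_of_mem hu)
  rw [tauForm_apply, tauForm_apply, conjR_apply, conjR_apply, inv_inv, hinv, star_smul, Complex.star_def, Complex.conj_ofReal, star_mul, star_mul,
    star_star, smul_mul_assoc, mul_smul_comm, map_smul, map_smul]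
  congr 2
  -- traciality: `τ(T* · (v* T X)) = τ((v* T X) · T*)`
  calc τ (star (T : 𝔸) * (star v * (T : 𝔸)) * X) = τ ((star v * (T : 𝔸) * X) * star (T : 𝔸)) := by
        rw [show star (T : 𝔸) * (star v * (T : 𝔸)) * X = star (T : 𝔸) * (star v * (T : 𝔸) * X) by noncomm_ring, hτt]
    _ = τ (star v * ((T : 𝔸) * X * star (T : 𝔸))) := by
        congr 1
        noncomm_ring

/-- ★★ **THE TRANSPOSE OF `X ↦ m·R(T)X` IS `v ↦ m·R(T⁻¹)v`** (unitary `T`, real `m`, tracial faithful positive `τ`) — the column-wise identity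
behind «`Q*(U)` transports with the inverse transporters» when the knit's `Q_jᵀ` is built with `entryT`.
[cite: Balaban1985BackgroundPropagators, (3.13) p.393, (3.16) p.393, p.391 («X·Y = tr XY»)] -/
theorem entryT_smul_conjR (hτp : ∀ a : 𝔸, a ≠ 0 → 0 < (τ (star a * a)).re) (hτt : ∀ a b : 𝔸, τ (a * b) = τ (b * a))
    {T : 𝔸ˣ} (hT : T ∈ unitaryUnits 𝔸) (m : ℝ) (v : 𝔸) :
    entryT τ (fun X => ((m : ℝ) : ℂ) • conjR T X) v = ((m : ℝ) : ℂ) • conjR T⁻¹ v := by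
  refine entryT_eq_of_forall_tauForm τ hτp (fun x y => ?_) (fun c x => ?_) fun X => tauForm_conjR_inv_left τ hτt hT m v X
  · simp only [conjR_apply, mul_add, add_mul, smul_add]
  · simp only [conjR_apply, mul_smul_comm, smul_mul_assoc]
    rw [smul_comm]

/-- `(X ↦ m·X)ᵀ v = m·v` (the case `T = 1`). [cite: Balaban1985BackgroundPropagators, (3.16) p.393, bookkeeping] -/
theorem entryT_smul (hτp : ∀ a : 𝔸, a ≠ 0 → 0 < (τ (star a * a)).re) (hτt : ∀ a b : 𝔸, τ (a * b) = τ (b * a)) (m : ℝ) (v : 𝔸) :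
    entryT τ (fun X => ((m : ℝ) : ℂ) • X) v = ((m : ℝ) : ℂ) • v := by
  have h := entryT_smul_conjR τ hτp hτt (T := 1) (Subgroup.one_mem _) m v
  simpa [conjR_apply] using h

/-! ## §3 One column of the comparison -/

/-- ★ **ONE COLUMN OF THE TRANSPOSE COMPARISON**: if `‖E₁X − E₂X‖ ≤ δ‖X‖` and `‖E₂X‖ ≤ K₂‖X‖` for all `X`, then
`‖E₁ᵀv₁ − E₂ᵀv₂‖ ≤ C_τβ_τ·(δ‖v₁‖ + K₂‖v₁ − v₂‖)`. [cite: Balaban1985Averaging, (147) p.40; Balaban1985BackgroundPropagators, (3.16) p.393] -/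
theorem norm_entryT_pair_sub_le [Nontrivial 𝔸] {Cτ : ℝ} (hCτ : ∀ x y : 𝔸, |(τ (star x * y)).re| ≤ Cτ * ‖x‖ * ‖y‖) {E₁ E₂ : 𝔸 → 𝔸}
    {δ K₂ : ℝ} (hδ : 0 ≤ δ) (hK₂ : 0 ≤ K₂) (h : ∀ X, ‖E₁ X - E₂ X‖ ≤ δ * ‖X‖) (h₂ : ∀ X, ‖E₂ X‖ ≤ K₂ * ‖X‖) (v₁ v₂ : 𝔸) :
    ‖entryT τ E₁ v₁ - entryT τ E₂ v₂‖ ≤ Cτ * betaTau τ * (δ * ‖v₁‖ + K₂ * ‖v₁ - v₂‖) := by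
  have hsplit : entryT τ E₁ v₁ - entryT τ E₂ v₂ = (entryT τ E₁ v₁ - entryT τ E₂ v₁) + entryT τ E₂ (v₁ - v₂) := by
    rw [entryT_sub_right]; abel
  rw [hsplit]
  refine (norm_add_le _ _).trans ?_
  have b1 := norm_entryT_sub_left_le τ hCτ hδ h v₁
  have b2 := norm_entryT_le τ hCτ hK₂ (fun i => h₂ _) (v₁ - v₂)
  calc _ ≤ Cτ * betaTau τ * δ * ‖v₁‖ + Cτ * betaTau τ * K₂ * ‖v₁ - v₂‖ := add_le_add b1 b2
    _ = Cτ * betaTau τ * (δ * ‖v₁‖ + K₂ * ‖v₁ - v₂‖) := by ring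

end Literature.MathematicalPhysics.QuantumFieldTheory.Balaban1983to89.B9B8KnitKernelTranspose
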